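import Summits.Parity.BatemanHorn.Theorems.SelbergDelangeRigidityLSDRealSegmentTailsTwoRankinPrep
import Summits.Parity.BatemanHorn.Theorems.SelbergDelangeRigidityLSDRealSegmentTailsLinearAux
import HarnessLib

/-!
# Route `SelbergDelangeRigidity`, crux `LSDRealSegment` (stmt-Parity-9770), line
# `product-anatomy-subcritical`: clause (b) of `stub_tailsTwo` (the Rankin tail) in total degree `2` FROM THE ENGINE

`tailsTwo_rankinTail_of_engine` (registered helper): clause (b) of `stub_tailsTwo`, `RankinTail k f y`, for a Bateman–Horn system `f` of total degree
`2` and `1 ≤ y < 2` — the landed `tailsTwo_rankinTail_of_facts` (`…TailsTwoRankin.lean`: same proof, its helpers reused) made UNCONDITIONAL by taking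
as hypotheses (E) the conclusion of the small-prime restoration engine for `(f, y)` (the body of `tailsTwo_engine` at `B = 1`, every `A ≥ 1` and cut
`P`) and clause (a) `APrioriBound k f y`.  Purpose: the engine's named inputs changed (`NairTenenbaum1998_theorem1` is MISSTATED — Henriot's `α < 1`
vs the printed `α < 1/2`, Erratum 2 of `NairTenenbaumShortSums.lean`; the engine needs `α = 1/4` — and `BugeaudEvertseGyory2018_SPartPolynomialValues`
is now proved); the clause is re-assembled on `NairTenenbaum1998_theorem1_printed` in `…TailsTwoPrinted.lean`.
-/

open Filter Finset Polynomial
open scoped BigOperators Topology Classical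

namespace Summit.Parity.BatemanHorn.Cruxes.LSDRealSegment.ProductAnatomySubcritical

open Literature.NumberTheory.Sieve
open ArithmeticFunction (cardFactors)
noncomputable section

set_option maxHeartbeats 3000000 in
/-- **tailsTwo_rankinTail_of_engine** (registered helper of `stub_tailsTwo`, line `product-anatomy-subcritical`): clause (b) of `stub_tailsTwo`,
`RankinTail k f y`, in total degree `2`, `1 ≤ y < 2`, GIVEN (E) the engine bound for `(f, y)` (body of `tailsTwo_engine`, `B = 1`) and clause (a)
`APrioriBound k f y`; proof of `tailsTwo_rankinTail_of_facts` verbatim. [folklore] -/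
theorem tailsTwo_rankinTail_of_engine : ∀ (k : ℕ) (f : Fin k → ℤ[X]), IsBatemanHornSystem f → (∑ i, (f i).natDegree) = 2 →
    ∀ y : ℝ, 1 ≤ y → y < 2 →
    (∀ (A : ℝ) (P : ℕ), 1 ≤ A → ∃ C : ℝ, ∃ X₀ : ℕ, 0 ≤ C ∧ ∀ (F : Fin k → ℕ → ℝ),
      (∀ i, IsClassM A 1 ((1 - Real.logb 2 y) / (9216 * (k + 1))) (F i)) → (∀ i m, F i m = F i (roughPart (P : ℝ) m)) →
      (∀ i, F i 1 ≤ 1) → ∀ (𝒮 : (Fin k → ℕ) → Prop) (X : ℕ), X₀ ≤ X →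
        (∑ n ∈ (Finset.Ioc X (2 * X)).filter (fun n => 𝒮 (fun i => smoothPart (P : ℝ) (val f i n))),
            ∏ i, (y ^ cardFactors (smoothPart (P : ℝ) (val f i n)) * F i (val f i n))) ≤
          C * ((X : ℝ) / Real.log X ^ k) * (∏ i, ∑ m ∈ Finset.Icc 1 (2 * X), F i m * (polyRootCountMod ![f i] m : ℝ) / m) *
              (∑ s ∈ (Fintype.piFinset fun _ : Fin k => Finset.Icc 1 X).filter (fun s => (∀ i, ∀ p ∈ (s i).primeFactors, p ≤ P) ∧ 𝒮 s),
                y ^ cardFactors (∏ i, s i) * (#((Finset.range (Finset.univ.lcm s * primorial P)).filter (fun r : ℕ =>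
                  ∀ i, ((s i : ℕ) : ℤ) ∣ (f i).eval (r : ℤ) ∧ ∀ p ∈ Nat.primesLE P, ¬ ((p ^ ((s i).factorization p + 1) : ℕ) : ℤ) ∣ (f i).eval (r : ℤ))) : ℝ) /
                  ((Finset.univ.lcm s * primorial P : ℕ) : ℝ)) + (X : ℝ) ^ (1 - (1 - Real.logb 2 y) / 6)) →
    APrioriBound k f y → RankinTail k f y := by
  intro k f hf hdeg y hy hy2 hE hApr ε hε
  have hy0 : 0 ≤ y := by linarith
  have hk1 : 1 ≤ k := by rcases eq_one_or_two_of_sum_natDegree hf hdeg with rfl | rfl <;> omega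
  have hkr : (1 : ℝ) ≤ k := by exact_mod_cast hk1
  set lam : ℝ := Real.logb 2 y with hlam
  have hlam1 : lam < 1 := by rw [hlam, Real.logb_lt_iff_lt_rpow one_lt_two (by linarith), Real.rpow_one]; exact hy2
  set θ : ℝ := (1 - lam) / 6 with hθdef
  have hθ : 0 < θ := by rw [hθdef]; linarith
  set ε₁ : ℝ := (1 - Real.logb 2 y) / (9216 * (k + 1)) with hε₁def
  have hε₁ : 0 < ε₁ := by rw [hε₁def]; exact div_pos (by rw [← hlam]; linarith) (by positivity)
  set P : ℕ := ⌊y ^ (2 / ε₁)⌋₊ + 1 with hPdef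
  have hP1 : 1 ≤ P := by omega
  have hPr : (1 : ℝ) ≤ P := by exact_mod_cast hP1
  have hyP2 : y ≤ (P : ℝ) ^ (ε₁ / 2) := by
    have h1 : y ^ (2 / ε₁) ≤ (P : ℝ) := by rw [hPdef]; push_cast; exact (Nat.lt_floor_add_one _).le
    calc y = (y ^ (2 / ε₁)) ^ (ε₁ / 2) := by
          rw [← Real.rpow_mul hy0, show 2 / ε₁ * (ε₁ / 2) = 1 by field_simp, Real.rpow_one]
      _ ≤ (P : ℝ) ^ (ε₁ / 2) := Real.rpow_le_rpow (by positivity) h1 (by positivity)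
  have hyP : y ≤ (P : ℝ) ^ ε₁ := hyP2.trans (Real.rpow_le_rpow_of_exponent_le hPr (by linarith))
  obtain ⟨hclsP, hFr, hF1, hFle⟩ := peeledWeight_props hy hε₁ hP1 hyP
  have hclsP' : IsClassM (3 * y) 1 ε₁ (fun m => y ^ cardFactors (roughPart (P : ℝ) m)) := IsClassM.mono_A hy0 (by linarith) hclsP
  obtain ⟨C, X₀, hC0, hengine⟩ := hE (3 * y) P (by linarith)
  obtain ⟨Ch', hCh'⟩ := tails_rootCountHarmonic_le k f hf y hy hy2
  obtain ⟨CR, hCR0, hCR⟩ := harmonic_rankin hf hy hy2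
  set Cm : ℝ := max (max Ch' 0) CR with hCmdef
  have hCm0 : 0 ≤ Cm := le_trans (le_max_right _ _) (le_max_left _ _)
  obtain ⟨Kz, hKz0, hKz⟩ := tailsTwo_classDensity_le k f hf hdeg P
  obtain ⟨⟨Ks, hKs⟩, htail⟩ := tailsTwo_smoothSeries y P hy hy2
  have hKs0 : 0 ≤ Ks := le_trans (Finset.sum_nonneg fun m _ => by positivity) (hKs 1)
  obtain ⟨Ca, hCa⟩ := hApr
  set e : ℝ := (k : ℝ) * (y - 1) with he
  have he0 : 0 ≤ e := by positivity
  set D : ℝ := C * 2 ^ k * (Cm * 2 ^ y) ^ k * (Kz * (Ks + 1) ^ k) with hD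
  have hD0 : 0 ≤ D := by positivity
  set KR : ℝ := 8 * k * D + 1 with hKR
  have hKR0 : 0 < KR := by positivity
  refine ⟨2 * (KR / ε), by positivity, fun θR τ hθR hRτ hτ1 => ?_⟩
  have hτ0 : 0 < τ := lt_of_lt_of_le (by positivity) hRτ
  have hsave : (k : ℝ) * D * Real.exp (-(τ / (2 * θR))) ≤ ε / 8 := by
    have h1 : KR / ε ≤ τ / (2 * θR) := by
      rw [le_div_iff₀ (by positivity)]
      calc KR / ε * (2 * θR) = 2 * (KR / ε) * θR := by ring
        _ ≤ τ := hRτ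
    have h2 := exp_neg_mul_le hKR0 hε h1
    calc (k : ℝ) * D * Real.exp (-(τ / (2 * θR))) ≤ (KR / 8) * Real.exp (-(τ / (2 * θR))) :=
          mul_le_mul_of_nonneg_right (by rw [hKR]; linarith) (Real.exp_pos _).le
      _ = Real.exp (-(τ / (2 * θR))) * KR / 8 := by ring
      _ ≤ ε / 8 := by linarith
  set ε' : ℝ := ε / KR with hε'
  have hε'0 : 0 < ε' := by positivity
  have htail' : (k : ℝ) * D * ε' ≤ ε / 8 := by
    rw [hε', show (k : ℝ) * D * (ε / KR) = (k * D * ε) / KR by ring, div_le_iff₀ hKR0]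
    have : ε / 8 * KR = k * D * ε + ε / 8 := by rw [hKR]; ring
    rw [this]; linarith
  obtain ⟨T₀, hT₀⟩ := htail ε' hε'0
  have hCa0 : 0 ≤ Ca := by
    have h := hCa 2 le_rfl
    have h0 : 0 ≤ ∑ n ∈ Finset.range (2 + 1), y ^ stat f n := Finset.sum_nonneg fun n _ => by positivity
    have hl : 0 < ((2 : ℕ) : ℝ) * Real.log ((2 : ℕ) : ℝ) ^ e := by have : 0 < Real.log ((2 : ℕ) : ℝ) := Real.log_pos (by norm_num); positivity
    by_contra hneg
    push Not at hneg
    have := mul_neg_of_neg_of_pos hneg hl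
    linarith
  have hl2e : 0 < Real.log 2 ^ e := Real.rpow_pos_of_pos (Real.log_pos one_lt_two) e
  obtain ⟨x₀, hx₀⟩ := Filter.eventually_atTop.mp (rankin_eventually X₀ T₀ (max (2 / (θR * ε₁)) (8 / (θR * (2 - y))))
    (16 * (Ca + 1) / ε) (64 * k / (ε * Real.log 2 ^ e)) hτ0 (half_pos hθ))
  refine Filter.eventually_atTop.mpr ⟨x₀, fun x hx => ?_⟩
  obtain ⟨c1, c2, c3, c4, c5, c6, c7⟩ := hx₀ x hx
  have hx8 : (8 : ℝ) ≤ x := by exact_mod_cast c2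
  have hxpos : (0 : ℝ) < x := by linarith
  have hx1 : (1 : ℝ) < x := by linarith
  have hlogx : 0 < Real.log x := Real.log_pos hx1
  have hlog2x : Real.log 2 ≤ Real.log x := Real.log_le_log two_pos (by linarith)
  set σ : ℝ := 1 / (θR * Real.log x) with hσ
  set z : ℝ := (x : ℝ) ^ θR with hz
  have hσ0 : 0 < σ := by positivity
  have hz1 : 1 ≤ z := Real.one_le_rpow hx1.le hθR.le
  have hσz : σ * Real.log z = 1 := by rw [hz, Real.log_rpow hxpos, hσ]; field_simp
  have hσε : σ ≤ ε₁ / 2 := by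
    have h3 : 2 / (θR * ε₁) ≤ Real.log x := le_trans (le_max_left _ _) c3
    rw [div_le_iff₀ (by positivity)] at h3
    rw [hσ, div_le_div_iff₀ (by positivity) two_pos]
    have : ε₁ * (θR * Real.log x) = Real.log x * (θR * ε₁) := by ring
    linarith
  have hσy : σ ≤ (2 - y) / 8 := by
    have hy8 : 0 < θR * (2 - y) := by nlinarith
    have h3 : 8 / (θR * (2 - y)) ≤ Real.log x := le_trans (le_max_right _ _) c3
    rw [div_le_iff₀ hy8] at h3
    rw [hσ, div_le_div_iff₀ (by positivity) (by norm_num)]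
    have : (2 - y) * (θR * Real.log x) = Real.log x * (θR * (2 - y)) := by ring
    linarith
  obtain ⟨hclsR, hFrR, hF1R⟩ := tailsTwo_rankinWeight_isClassM y ε₁ z σ P hy hε₁ hP1 hyP2 hσ0.le hσε hσz.le
  set M : ℕ := ⌊(x : ℝ) ^ (1 / 2 : ℝ)⌋₊ + 1 with hMdef
  have hMsqrt : (x : ℝ) ^ (1 / 2 : ℝ) < M := by rw [hMdef]; push_cast; exact Nat.lt_floor_add_one _
  have hMle : (M : ℝ) ≤ (x : ℝ) ^ (1 / 2 : ℝ) + 1 := by rw [hMdef]; push_cast; linarith [Nat.floor_le (Real.rpow_nonneg hxpos.le (1 / 2 : ℝ))]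
  have hsqx : (x : ℝ) ^ (1 / 2 : ℝ) * (x : ℝ) ^ (1 / 2 : ℝ) = x := by rw [← Real.rpow_add hxpos]; norm_num
  have hMX₀ : X₀ ≤ M := by
    have : (X₀ : ℝ) ≤ M := by linarith
    exact_mod_cast this
  have hM1 : 1 ≤ M := by omega
  have h2Mx : 2 * M ≤ x := by
    have hs2 : (2 : ℝ) ≤ (x : ℝ) ^ (1 / 2 : ℝ) := by linarith [show (0 : ℝ) ≤ X₀ from Nat.cast_nonneg X₀]
    have : 2 * (M : ℝ) ≤ x := by nlinarith
    exact_mod_cast this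
  set sp : ℕ → Fin k → ℕ := fun n j => smoothPart (P : ℝ) (val f j n) with hsp
  set Fp : Fin k → ℕ → ℝ := fun _ m => y ^ cardFactors (roughPart (P : ℝ) m) with hFp
  set FR : Fin k → Fin k → ℕ → ℝ := fun i j m => y ^ cardFactors (roughPart (P : ℝ) m) *
    (if j = i then (smoothPart z (roughPart (P : ℝ) m) : ℝ) ^ σ else 1) with hFR
  set cls : ℕ → Prop := fun n => ∃ i, (x : ℝ) ^ τ < (smoothPart ((x : ℝ) ^ θR) (val f i n) : ℝ) with hcls
  set w : ℕ → ℝ := fun n => if cls n then y ^ stat f n else 0 with hw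
  have hw0 : ∀ n, 0 ≤ w n := fun n => by simp only [hw]; split_ifs <;> positivity
  have hHarm : ∀ (i : Fin k) (X : ℕ), M ≤ X → X ≤ x → ∀ j,
      (∑ m ∈ Finset.Icc 1 (2 * X), Fp j m * (polyRootCountMod ![f j] m : ℝ) / m ≤ Cm * 2 ^ y * Real.log x ^ y) ∧
      (∑ m ∈ Finset.Icc 1 (2 * X), FR i j m * (polyRootCountMod ![f j] m : ℝ) / m ≤ Cm * 2 ^ y * Real.log x ^ y) := by
    intro i X hMX hXx j
    have hX2 : 2 ≤ 2 * X := by omega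
    have hlog2X : Real.log ((2 * X : ℕ) : ℝ) ≤ 2 * Real.log x := by
      have hXr : ((2 * X : ℕ) : ℝ) ≤ 2 * x := by exact_mod_cast Nat.mul_le_mul_left 2 hXx
      calc Real.log ((2 * X : ℕ) : ℝ) ≤ Real.log (2 * x) := Real.log_le_log (by positivity) hXr
        _ = Real.log 2 + Real.log x := Real.log_mul two_ne_zero hxpos.ne'
        _ ≤ 2 * Real.log x := by linarith
    have hpowlog : Real.log ((2 * X : ℕ) : ℝ) ^ y ≤ 2 ^ y * Real.log x ^ y := by
      calc Real.log ((2 * X : ℕ) : ℝ) ^ y ≤ (2 * Real.log x) ^ y := Real.rpow_le_rpow (Real.log_natCast_nonneg _) hlog2X hy0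
        _ = 2 ^ y * Real.log x ^ y := Real.mul_rpow zero_le_two hlogx.le
    have hCh : ∑ m ∈ Finset.Icc 1 (2 * X), y ^ cardFactors m * (polyRootCountMod ![f j] m : ℝ) / m ≤ Cm * 2 ^ y * Real.log x ^ y := by
      calc _ ≤ Ch' * Real.log ((2 * X : ℕ) : ℝ) ^ y := hCh' j (2 * X) hX2
        _ ≤ Cm * Real.log ((2 * X : ℕ) : ℝ) ^ y := mul_le_mul_of_nonneg_right
            ((le_max_left _ _).trans (le_max_left _ _)) (Real.rpow_nonneg (Real.log_natCast_nonneg _) y)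
        _ ≤ Cm * (2 ^ y * Real.log x ^ y) := mul_le_mul_of_nonneg_left hpowlog hCm0
        _ = _ := by ring
    constructor
    · refine le_trans (Finset.sum_le_sum fun m _ => div_le_div_of_nonneg_right
        (mul_le_mul_of_nonneg_right (hFle m) (Nat.cast_nonneg _)) (Nat.cast_nonneg _)) hCh
    · by_cases hji : j = i
      · subst hji
        simp only [hFR, if_true]
        calc _ ≤ ∑ m ∈ Finset.Icc 1 (2 * X), y ^ cardFactors m * (smoothPart z m : ℝ) ^ σ * (polyRootCountMod ![f j] m : ℝ) / m :=
              Finset.sum_le_sum fun m _ => div_le_div_of_nonneg_right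
                (mul_le_mul_of_nonneg_right (rankinWeight_le hy hσ0.le P m) (Nat.cast_nonneg _)) (Nat.cast_nonneg _)
          _ ≤ CR * Real.log ((2 * X : ℕ) : ℝ) ^ y := hCR j (2 * X) z σ hX2 hz1 hσ0.le hσy hσz.le
          _ ≤ Cm * Real.log ((2 * X : ℕ) : ℝ) ^ y := mul_le_mul_of_nonneg_right (le_max_right _ _) (Real.rpow_nonneg (Real.log_natCast_nonneg _) y)
          _ ≤ Cm * (2 ^ y * Real.log x ^ y) := mul_le_mul_of_nonneg_left hpowlog hCm0
          _ = _ := by ring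
      · simp only [hFR, if_neg hji, mul_one]
        exact le_trans (Finset.sum_le_sum fun m _ => div_le_div_of_nonneg_right
          (mul_le_mul_of_nonneg_right (hFle m) (Nat.cast_nonneg _)) (Nat.cast_nonneg _)) hCh
  have hprodH : ∀ (G : Fin k → ℕ → ℝ) (X : ℕ), (∀ j, 0 ≤ ∑ m ∈ Finset.Icc 1 (2 * X), G j m * (polyRootCountMod ![f j] m : ℝ) / m) →
      (∀ j, ∑ m ∈ Finset.Icc 1 (2 * X), G j m * (polyRootCountMod ![f j] m : ℝ) / m ≤ Cm * 2 ^ y * Real.log x ^ y) →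
      ∏ j, ∑ m ∈ Finset.Icc 1 (2 * X), G j m * (polyRootCountMod ![f j] m : ℝ) / m ≤ (Cm * 2 ^ y) ^ k * Real.log x ^ (y * k) := by
    intro G X h0 h1
    calc _ ≤ ∏ _j : Fin k, Cm * 2 ^ y * Real.log x ^ y := Finset.prod_le_prod (fun j _ => h0 j) fun j _ => h1 j
      _ = (Cm * 2 ^ y) ^ k * (Real.log x ^ y) ^ k := by rw [Finset.prod_const, Finset.card_univ, Fintype.card_fin, mul_pow]
      _ = _ := by rw [← Real.rpow_natCast (Real.log x ^ y), ← Real.rpow_mul hlogx.le]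
  have hek : y * k - k = e := by rw [he]; ring
  have hmain : ∀ X : ℕ, M ≤ X → X ≤ x → ∀ (H Z : ℝ), 0 ≤ Z → H ≤ (Cm * 2 ^ y) ^ k * Real.log x ^ (y * k) →
      C * ((X : ℝ) / Real.log X ^ k) * H * Z ≤ C * 2 ^ k * (Cm * 2 ^ y) ^ k * ((X : ℝ) * Real.log x ^ e) * Z := by
    intro X hMX _ H Z hZ0 hH
    have h := engine_mainTerm_le hC0 hCm0 hx1 (lt_of_lt_of_le hMsqrt (by exact_mod_cast hMX)) hZ0 hH
    rwa [hek] at h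
  -- THE BLOCK BOUND
  have hblk : ∀ X : ℕ, M ≤ X → X ≤ x → ∑ n ∈ Finset.Ioc X (2 * X), w n ≤ (ε / 4 * Real.log x ^ e + 2 * k * (x : ℝ) ^ (-(θ / 2))) * X := by
    intro X hMX hXx
    have hXX₀ : X₀ ≤ X := hMX₀.trans hMX
    have hXr : (x : ℝ) ^ (1 / 2 : ℝ) < X := lt_of_lt_of_le hMsqrt (by exact_mod_cast hMX)
    have hX0 : (0 : ℝ) < X := lt_of_le_of_lt (by positivity) hXr
    have hXθ : (X : ℝ) ^ (1 - (1 - Real.logb 2 y) / 6) ≤ (x : ℝ) ^ (-(θ / 2)) * X := by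
      rw [show (1 : ℝ) - (1 - Real.logb 2 y) / 6 = 1 - θ by rw [hθdef, hlam], Real.rpow_sub hX0, Real.rpow_one,
        div_le_iff₀ (Real.rpow_pos_of_pos hX0 θ)]
      have h1 : (x : ℝ) ^ (θ / 2) ≤ (X : ℝ) ^ θ := by
        calc (x : ℝ) ^ (θ / 2) = ((x : ℝ) ^ (1 / 2 : ℝ)) ^ θ := by rw [← Real.rpow_mul hxpos.le]; ring_nf
          _ ≤ (X : ℝ) ^ θ := Real.rpow_le_rpow (by positivity) hXr.le hθ.le
      calc (X : ℝ) = (x : ℝ) ^ (-(θ / 2)) * X * (x : ℝ) ^ (θ / 2) := by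
            rw [Real.rpow_neg hxpos.le]; field_simp
        _ ≤ (x : ℝ) ^ (-(θ / 2)) * X * (X : ℝ) ^ θ := mul_le_mul_of_nonneg_left h1 (by positivity)
    -- PART I for member `i`
    have hI : ∀ i : Fin k, ∑ n ∈ (Finset.Ioc X (2 * X)).filter (fun n => (x : ℝ) ^ (τ / 2) < (sp n i : ℝ)), y ^ stat f n ≤
        D * ε' * ((X : ℝ) * Real.log x ^ e) + (x : ℝ) ^ (-(θ / 2)) * X := by
      intro i
      have h := hengine Fp (fun _ => hclsP') (fun _ m => hFr m) (fun _ => hF1) (fun s => (x : ℝ) ^ (τ / 2) < (s i : ℝ)) X hXX₀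
      rw [Finset.sum_congr rfl fun n _ => pow_stat_eq_prod_smooth_rough f y P n]
      refine h.trans (add_le_add ?_ hXθ)
      have hZ := Zsum_le_prod (f := f) (P := P) hy0 hKz0 hKz (fun s => (x : ℝ) ^ (τ / 2) < (s i : ℝ)) X
        (fun j => if j = i then (Finset.Icc 1 X).filter (fun m : ℕ => (∀ p ∈ m.primeFactors, p ≤ P) ∧ T₀ < m)
          else (Finset.Icc 1 X).filter (fun m : ℕ => ∀ p ∈ m.primeFactors, p ≤ P)) (by
          intro s hs hsP h𝒮 j
          by_cases hji : j = i
          · subst hji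
            rw [if_pos rfl, Finset.mem_filter]
            refine ⟨hs j, hsP j, ?_⟩
            have : (T₀ : ℝ) < s j := lt_of_le_of_lt c4 h𝒮
            exact_mod_cast this
          · rw [if_neg hji, Finset.mem_filter]; exact ⟨hs j, hsP j⟩)
      have hprod : ∏ j, ∑ m ∈ (if j = i then (Finset.Icc 1 X).filter (fun m : ℕ => (∀ p ∈ m.primeFactors, p ≤ P) ∧ T₀ < m)
          else (Finset.Icc 1 X).filter (fun m : ℕ => ∀ p ∈ m.primeFactors, p ≤ P)), y ^ cardFactors m / m ≤ ε' * (Ks + 1) ^ k := by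
        rw [← Finset.prod_erase_mul _ _ (Finset.mem_univ i), if_pos rfl, mul_comm]
        have h1 : ∏ j ∈ Finset.univ.erase i, ∑ m ∈ (if j = i then (Finset.Icc 1 X).filter
            (fun m : ℕ => (∀ p ∈ m.primeFactors, p ≤ P) ∧ T₀ < m) else (Finset.Icc 1 X).filter
            (fun m : ℕ => ∀ p ∈ m.primeFactors, p ≤ P)), y ^ cardFactors m / m ≤ (Ks + 1) ^ k := by
          calc _ ≤ ∏ _j ∈ Finset.univ.erase i, (Ks + 1) := by
                refine Finset.prod_le_prod (fun j _ => Finset.sum_nonneg fun m _ => by positivity) fun j hj => ?_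
                rw [if_neg (Finset.ne_of_mem_erase hj)]
                linarith [hKs X]
            _ = (Ks + 1) ^ (k - 1) := by rw [Finset.prod_const, Finset.card_erase_of_mem (Finset.mem_univ i), Finset.card_univ, Fintype.card_fin]
            _ ≤ (Ks + 1) ^ k := pow_le_pow_right₀ (by linarith) (Nat.sub_le k 1)
        exact mul_le_mul (hT₀ X) h1 (Finset.prod_nonneg fun j _ => Finset.sum_nonneg fun m _ => by positivity) hε'0.le
      have hH := hprodH Fp X (fun j => Finset.sum_nonneg fun m _ => by positivity) fun j => (hHarm i X hMX hXx j).1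
      calc _ ≤ C * 2 ^ k * (Cm * 2 ^ y) ^ k * ((X : ℝ) * Real.log x ^ e) * _ :=
            hmain X hMX hXx _ _ (Finset.sum_nonneg fun s _ => div_nonneg (mul_nonneg (pow_nonneg hy0 _) (Nat.cast_nonneg _))
              (Nat.cast_nonneg _)) hH
        _ ≤ C * 2 ^ k * (Cm * 2 ^ y) ^ k * ((X : ℝ) * Real.log x ^ e) * (Kz * (ε' * (Ks + 1) ^ k)) :=
            mul_le_mul_of_nonneg_left (hZ.trans (mul_le_mul_of_nonneg_left hprod hKz0)) (by positivity)
        _ = D * ε' * ((X : ℝ) * Real.log x ^ e) := by rw [hD]; ring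
    -- PART II for member `i`
    have hII : ∀ i : Fin k, ∑ n ∈ Finset.Ioc X (2 * X), y ^ stat f n * (smoothPart z (roughPart (P : ℝ) (val f i n)) : ℝ) ^ σ ≤
        D * ((X : ℝ) * Real.log x ^ e) + (x : ℝ) ^ (-(θ / 2)) * X := by
      intro i
      have hclsi : ∀ j, IsClassM (3 * y) 1 ε₁ (FR i j) := by
        intro j
        by_cases hji : j = i
        · subst hji
          have : FR j j = fun m => y ^ cardFactors (roughPart (P : ℝ) m) * (smoothPart z (roughPart (P : ℝ) m) : ℝ) ^ σ := by
            funext m; simp only [hFR, if_true]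
          rw [this]; exact hclsR
        · have : FR i j = fun m => y ^ cardFactors (roughPart (P : ℝ) m) := by
            funext m; simp only [hFR, if_neg hji, mul_one]
          rw [this]; exact hclsP'
      have hFri : ∀ j m, FR i j m = FR i j (roughPart (P : ℝ) m) := by intro j m; simp only [hFR, roughPart_roughPart]
      have hF1i : ∀ j, FR i j 1 ≤ 1 := by
        intro j; simp only [hFR]
        split_ifs
        · exact hF1R
        · rw [mul_one]; exact hF1
      have h := hengine (FR i) hclsi hFri hF1i (fun _ => True) X hXX₀
      simp only [Finset.filter_true] at h
      rw [← Finset.sum_congr rfl fun n _ => prod_rankinSummand_eq f y z σ P n i]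
      refine (le_of_eq (Finset.sum_congr rfl fun n _ => ?_)).trans (h.trans (add_le_add ?_ hXθ))
      · simp only [hFR]
      have hZ := Zsum_le_prod (f := f) (P := P) hy0 hKz0 hKz (fun _ => True) X
        (fun _ => (Finset.Icc 1 X).filter (fun m : ℕ => ∀ p ∈ m.primeFactors, p ≤ P))
        (fun s hs hsP _ j => Finset.mem_filter.mpr ⟨hs j, hsP j⟩)
      have hprod : ∏ _j : Fin k, ∑ m ∈ (Finset.Icc 1 X).filter (fun m : ℕ => ∀ p ∈ m.primeFactors, p ≤ P), y ^ cardFactors m / m ≤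
          (Ks + 1) ^ k := by
        calc _ ≤ ∏ _j : Fin k, (Ks + 1) := Finset.prod_le_prod (fun j _ => Finset.sum_nonneg fun m _ => by positivity)
              fun j _ => by linarith [hKs X]
          _ = _ := by rw [Finset.prod_const, Finset.card_univ, Fintype.card_fin]
      have hH := hprodH (FR i) X (fun j => Finset.sum_nonneg fun m _ => div_nonneg (mul_nonneg ((hclsi j).1 m)
        (Nat.cast_nonneg _)) (Nat.cast_nonneg _)) fun j => (hHarm i X hMX hXx j).2
      calc _ ≤ C * 2 ^ k * (Cm * 2 ^ y) ^ k * ((X : ℝ) * Real.log x ^ e) * _ :=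
            hmain X hMX hXx _ _ (Finset.sum_nonneg fun s _ => div_nonneg (mul_nonneg (pow_nonneg hy0 _) (Nat.cast_nonneg _))
              (Nat.cast_nonneg _)) hH
        _ ≤ C * 2 ^ k * (Cm * 2 ^ y) ^ k * ((X : ℝ) * Real.log x ^ e) * (Kz * (Ks + 1) ^ k) := by
            refine mul_le_mul_of_nonneg_left (le_trans ?_ (mul_le_mul_of_nonneg_left hprod hKz0)) (by positivity)
            convert hZ using 2
        _ = D * ((X : ℝ) * Real.log x ^ e) := by rw [hD]; ring
    have hpt : ∀ n ∈ Finset.Ioc X (2 * X), w n ≤ ∑ i, ((if (x : ℝ) ^ (τ / 2) < (sp n i : ℝ) then y ^ stat f n else 0) +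
        Real.exp (-(τ / (2 * θR))) * (y ^ stat f n * (smoothPart z (roughPart (P : ℝ) (val f i n)) : ℝ) ^ σ)) := by
      intro n _
      simp only [hw]
      split_ifs with hc
      · exact tailsTwo_rankin_pointwise k f y P x n θR τ hy0 hθR hx1 hc
      · exact Finset.sum_nonneg fun i _ => add_nonneg (by split_ifs <;> positivity) (by positivity)
    refine (Finset.sum_le_sum hpt).trans ?_
    rw [Finset.sum_comm]
    have hrw : ∀ i, ∑ n ∈ Finset.Ioc X (2 * X), ((if (x : ℝ) ^ (τ / 2) < (sp n i : ℝ) then y ^ stat f n else 0) +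
        Real.exp (-(τ / (2 * θR))) * (y ^ stat f n * (smoothPart z (roughPart (P : ℝ) (val f i n)) : ℝ) ^ σ)) =
        ∑ n ∈ (Finset.Ioc X (2 * X)).filter (fun n => (x : ℝ) ^ (τ / 2) < (sp n i : ℝ)), y ^ stat f n +
          Real.exp (-(τ / (2 * θR))) * ∑ n ∈ Finset.Ioc X (2 * X), y ^ stat f n * (smoothPart z (roughPart (P : ℝ) (val f i n)) : ℝ) ^ σ := by
      intro i
      rw [Finset.sum_add_distrib, ← Finset.mul_sum, ← Finset.sum_filter]
    rw [Finset.sum_congr rfl fun i _ => hrw i]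
    have hexp1 : Real.exp (-(τ / (2 * θR))) ≤ 1 := by rw [Real.exp_le_one_iff]; exact neg_nonpos.mpr (by positivity)
    calc ∑ i, (∑ n ∈ (Finset.Ioc X (2 * X)).filter (fun n => (x : ℝ) ^ (τ / 2) < (sp n i : ℝ)), y ^ stat f n +
          Real.exp (-(τ / (2 * θR))) * ∑ n ∈ Finset.Ioc X (2 * X), y ^ stat f n * (smoothPart z (roughPart (P : ℝ) (val f i n)) : ℝ) ^ σ)
        ≤ ∑ _i : Fin k, ((D * ε' * ((X : ℝ) * Real.log x ^ e) + (x : ℝ) ^ (-(θ / 2)) * X) +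
          Real.exp (-(τ / (2 * θR))) * (D * ((X : ℝ) * Real.log x ^ e) + (x : ℝ) ^ (-(θ / 2)) * X)) :=
          Finset.sum_le_sum fun i _ => add_le_add (hI i) (mul_le_mul_of_nonneg_left (hII i) (Real.exp_pos _).le)
      _ = k * ((D * ε' + Real.exp (-(τ / (2 * θR))) * D) * Real.log x ^ e * X +
          (1 + Real.exp (-(τ / (2 * θR)))) * ((x : ℝ) ^ (-(θ / 2)) * X)) := by
          rw [Finset.sum_const, Finset.card_univ, Fintype.card_fin, nsmul_eq_mul]; ring
      _ ≤ (ε / 4 * Real.log x ^ e + 2 * k * (x : ℝ) ^ (-(θ / 2))) * X := by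
          have h1 : (k : ℝ) * (D * ε' + Real.exp (-(τ / (2 * θR))) * D) ≤ ε / 4 := by
            calc (k : ℝ) * (D * ε' + Real.exp (-(τ / (2 * θR))) * D) = k * D * ε' + k * D * Real.exp (-(τ / (2 * θR))) := by ring
              _ ≤ ε / 8 + ε / 8 := add_le_add htail' hsave
              _ = ε / 4 := by ring
          have h2 : (k : ℝ) * (1 + Real.exp (-(τ / (2 * θR)))) ≤ 2 * k := by
            calc (k : ℝ) * (1 + Real.exp (-(τ / (2 * θR)))) = k + k * Real.exp (-(τ / (2 * θR))) := by ring
              _ ≤ k + k * 1 := by gcongr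
              _ = 2 * k := by ring
          have h3 : 0 ≤ Real.log x ^ e * (X : ℝ) := by positivity
          have h4 : 0 ≤ (x : ℝ) ^ (-(θ / 2)) * X := by positivity
          calc _ = (k : ℝ) * (D * ε' + Real.exp (-(τ / (2 * θR))) * D) * (Real.log x ^ e * X) +
                (k : ℝ) * (1 + Real.exp (-(τ / (2 * θR)))) * ((x : ℝ) ^ (-(θ / 2)) * X) := by ring
            _ ≤ ε / 4 * (Real.log x ^ e * X) + 2 * k * ((x : ℝ) ^ (-(θ / 2)) * X) :=
                add_le_add (mul_le_mul_of_nonneg_right h1 h3) (mul_le_mul_of_nonneg_right h2 h4)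
            _ = _ := by ring
  have hE0 : 0 ≤ ε / 4 * Real.log x ^ e + 2 * k * (x : ℝ) ^ (-(θ / 2)) := by positivity
  have hasm := sum_Icc_le_of_blocks hw0 hE0 hM1 hblk x le_rfl
  have hlhs : ∑ n ∈ (Finset.Icc 1 x).filter (fun n : ℕ => ∃ i, (x : ℝ) ^ τ < (smoothPart ((x : ℝ) ^ θR) (val f i n) : ℝ)),
      y ^ stat f n = ∑ n ∈ Finset.Icc 1 x, w n := by rw [Finset.sum_filter]
  rw [hlhs]
  refine hasm.trans ?_
  have hshort : ∑ n ∈ Finset.Icc 1 (2 * M), w n ≤ Ca * ((2 * (x : ℝ) ^ (1 / 2 : ℝ) + 2) * Real.log x ^ e) := by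
    have h2M : 2 ≤ 2 * M := by omega
    calc ∑ n ∈ Finset.Icc 1 (2 * M), w n ≤ ∑ n ∈ Finset.Icc 1 (2 * M), y ^ stat f n :=
          Finset.sum_le_sum fun n _ => by simp only [hw]; split_ifs <;> linarith [pow_nonneg hy0 (stat f n)]
      _ ≤ ∑ n ∈ Finset.range (2 * M + 1), y ^ stat f n :=
          Finset.sum_le_sum_of_subset_of_nonneg (fun n hn => by rw [Finset.mem_Icc] at hn; rw [Finset.mem_range]; omega)
            fun n _ _ => by positivity
      _ ≤ Ca * (((2 * M : ℕ) : ℝ) * Real.log ((2 * M : ℕ) : ℝ) ^ ((k : ℝ) * (y - 1))) := hCa (2 * M) h2M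
      _ ≤ Ca * ((2 * (x : ℝ) ^ (1 / 2 : ℝ) + 2) * Real.log x ^ e) := by
          refine mul_le_mul_of_nonneg_left (mul_le_mul ?_ ?_ (by positivity) (by positivity)) hCa0
          · push_cast; linarith
          · exact Real.rpow_le_rpow (Real.log_natCast_nonneg _) (Real.log_le_log (by positivity) (by exact_mod_cast h2Mx)) he0
  have hfin1 : Ca * ((2 * (x : ℝ) ^ (1 / 2 : ℝ) + 2) * Real.log x ^ e) ≤ ε / 4 * ((x : ℝ) * Real.log x ^ e) := by
    have ha : 16 * (Ca + 1) / ε ≤ (x : ℝ) ^ (1 / 2 : ℝ) := c5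
    have hb : 16 * (Ca + 1) / ε ≤ x := c6
    rw [div_le_iff₀ hε] at ha hb
    have hs0 : 0 ≤ (x : ℝ) ^ (1 / 2 : ℝ) := Real.rpow_nonneg hxpos.le _
    have h1 : Ca * (2 * (x : ℝ) ^ (1 / 2 : ℝ) + 2) ≤ ε / 4 * x := by
      calc Ca * (2 * (x : ℝ) ^ (1 / 2 : ℝ) + 2) ≤ (Ca + 1) * (2 * (x : ℝ) ^ (1 / 2 : ℝ) + 2) :=
            mul_le_mul_of_nonneg_right (by linarith) (by positivity)
        _ = 2 * ((Ca + 1) * (x : ℝ) ^ (1 / 2 : ℝ)) + 2 * (Ca + 1) := by ring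
        _ ≤ 2 * (((x : ℝ) ^ (1 / 2 : ℝ) * ε / 16) * (x : ℝ) ^ (1 / 2 : ℝ)) + 2 * ((x : ℝ) * ε / 16) := by
            gcongr
            · linarith
            · linarith
        _ = ε / 8 * ((x : ℝ) ^ (1 / 2 : ℝ) * (x : ℝ) ^ (1 / 2 : ℝ)) + ε / 8 * x := by ring
        _ = ε / 4 * x := by rw [hsqx]; ring
    calc Ca * ((2 * (x : ℝ) ^ (1 / 2 : ℝ) + 2) * Real.log x ^ e) = Ca * (2 * (x : ℝ) ^ (1 / 2 : ℝ) + 2) * Real.log x ^ e := by ring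
      _ ≤ ε / 4 * x * Real.log x ^ e := mul_le_mul_of_nonneg_right h1 (Real.rpow_nonneg hlogx.le e)
      _ = _ := by ring
  have hfin2 : 2 * (2 * k * (x : ℝ) ^ (-(θ / 2))) * x ≤ ε / 4 * ((x : ℝ) * Real.log x ^ e) := by
    have hxθ : 0 < (x : ℝ) ^ (θ / 2) := Real.rpow_pos_of_pos hxpos _
    have h1 : 64 * k / (ε * Real.log 2 ^ e) ≤ (x : ℝ) ^ (θ / 2) := c7
    rw [div_le_iff₀ (by positivity)] at h1
    have h2 : Real.log 2 ^ e ≤ Real.log x ^ e := Real.rpow_le_rpow (Real.log_nonneg one_le_two) hlog2x he0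
    have h4 : 4 * k * (x : ℝ) ^ (-(θ / 2)) ≤ ε / 4 * Real.log x ^ e := by
      rw [Real.rpow_neg hxpos.le, ← div_eq_mul_inv, div_le_iff₀ hxθ]
      calc 4 * (k : ℝ) = (64 * k) / 16 := by ring
        _ ≤ (x : ℝ) ^ (θ / 2) * (ε * Real.log 2 ^ e) / 16 := by gcongr
        _ ≤ (x : ℝ) ^ (θ / 2) * (ε * Real.log x ^ e) / 16 := by gcongr
        _ ≤ ε / 4 * Real.log x ^ e * (x : ℝ) ^ (θ / 2) := by
            have : 0 ≤ (x : ℝ) ^ (θ / 2) * (ε * Real.log x ^ e) := by positivity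
            nlinarith
    calc 2 * (2 * k * (x : ℝ) ^ (-(θ / 2))) * x = (4 * k * (x : ℝ) ^ (-(θ / 2))) * x := by ring
      _ ≤ (ε / 4 * Real.log x ^ e) * x := mul_le_mul_of_nonneg_right h4 hxpos.le
      _ = _ := by ring
  calc (∑ n ∈ Finset.Icc 1 (2 * M), w n) + 2 * (ε / 4 * Real.log x ^ e + 2 * k * (x : ℝ) ^ (-(θ / 2))) * x
      ≤ ε / 4 * ((x : ℝ) * Real.log x ^ e) + (ε / 2 * ((x : ℝ) * Real.log x ^ e) + 2 * (2 * k * (x : ℝ) ^ (-(θ / 2))) * x) :=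
        add_le_add (hshort.trans hfin1) (le_of_eq (by ring))
    _ ≤ ε / 4 * ((x : ℝ) * Real.log x ^ e) + (ε / 2 * ((x : ℝ) * Real.log x ^ e) + ε / 4 * ((x : ℝ) * Real.log x ^ e)) := by
        linarith [hfin2]
    _ = ε * ((x : ℝ) * Real.log x ^ e) := by ring

end

end Summit.Parity.BatemanHorn.Cruxes.LSDRealSegment.ProductAnatomySubcritical
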